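import Literature.NumberTheory.Automorphic.AutomorphicInductionCharacterCubicProofs
import Literature.NumberTheory.Automorphic.AutomorphicInductionCuspidal
import Literature.NumberTheory.Automorphic.StrongArtinDihedralNotFixed
import Literature.NumberTheory.Automorphic.NormGroupClosedProofs
import Literature.NumberTheory.GaloisRepresentations.HeckeCharacterWeakApproximation
import HarnessLib

/-!
# Non-normal cubic automorphic induction of a unitary Hecke character: the Galois (cyclic)
# sub-case from Arthur–Clozel's Theorem 6.2 (proofs)

Topic `NumberTheory/Automorphic`; a proof file (theorems only: no definition, no named fact, no
instance) attached to the named fact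
`Literature.NumberTheory.Automorphic.automorphicInduction_unitaryCharacter_cubic`
(`AutomorphicInductionUnitaryCharacterCubic`; Jacquet–Piatetski-Shapiro–Shalika 1979, §§13–14, as
restated in Gelbart 1997, Thm. 5.3.1 with Remark 5.3.1 (e)).

The fact concerns an ARBITRARY cubic extension `E/F`.  When `E/F` happens to be Galois it is
cyclic of prime degree `3`, and the printed theorem is then also a case of Arthur–Clozel's cyclic
automorphic induction (Ann. of Math. Stud. 120 (1989), Ch. 3, Thm. 6.2, for `n = 1`), which the
tree carries as the named facts `automorphicInduction_cyclic` (`BaseChangeInductionAlong`,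
existence of the induced automorphic representation with the Hecke-eigenvalue relations of
Def. 6.1) and `automorphicInduction_cyclic_cuspidal` (`AutomorphicInductionCuspidal`, cuspidality
off the Galois-stable locus, Lemma 6.4).  This file proves that reduction, so that the genuinely
new content of the fact is isolated as its non-Galois case (Galois closure `S₃`), whose printed
proof is the converse theorem for `GL(3)`:

* `exists_automorphicRepData_cubic_of_isGalois` — clause (1) of the fact for `E/F` Galois of
  degree `3` and ANY Hecke character `θ` of `E`, from `automorphicInduction_cyclic`: the
  automorphic representation `π_θ` of `GL₁(𝔸_E)` (`exists_automorphicRepData_hasSatakeParamAt_valueAtUniformizer`,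
  a cuspidal datum since the cusp condition is empty for `n = 1`) is induced to an automorphic
  `P` on `GL₃(𝔸_F)` with `IsAutomorphicInductionAlong π_θ P`, which is the explicit identity
  `det(X - t_{P,v}) = ∏_{w ∣ v} (X^{f(w|v)} - θ(ϖ_w))` a.e.
  (`isAutomorphicInductionAlong_iff_of_hasSatakeParamAt_singleton`); the rank `1 · [E:F]` of the
  fact's conclusion is transported to `3` (`AutomorphicRepData.exists_hasSatakeParamAt_iff_of_eq`).
* `HeckeCharacter.frequently_exists_valueAtUniformizer_ne` — **rigidity bridge**: for `E/F`
  Galois, if two places over one place of `F` (the second unramified for `θ`) carry different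
  values of `θ`, then for INFINITELY many places `w` of `E` some conjugate place carries a
  different value (otherwise the conjugate character `θ^σ`, `σ w = w'`, agrees with `θ` at almost
  all uniformizers, so `θ^σ = θ` by `HeckeCharacter.ext_of_eventually_valueAtUniformizer_eq`,
  contradicting `θ(ϖ_{w'}) ≠ θ(ϖ_w)`); by uniqueness of Satake parameters this is
  `¬ IsGaloisStableSatakeAE F π_θ` (`not_isGaloisStableSatakeAE_of_frequently_ne`), the hypothesis
  of `automorphicInduction_cyclic_cuspidal`.
* `exists_cuspidal_cubic_of_isGalois` — clause (2) of the fact, verbatim (its single-place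
  regularity hypothesis), for `E/F` Galois of degree `3`, from `automorphicInduction_cyclic_cuspidal`.
* `automorphicInduction_unitaryCharacter_cubic_of_isGalois` — both clauses assembled: the fact
  restricted to Galois cubic `E/F` follows from the two Arthur–Clozel facts.

Nothing here discharges the fact (net debt unchanged): for `E/F` NOT Galois no named fact of the
tree applies (see the module docstring of `AutomorphicInductionUnitaryCharacterCubic` and the
seat notes: the `S₃`-closure-and-descent route leaves the Satake parameters at the places inert in
the quadratic resolvent undetermined up to signs).

## References

* J. Arthur, L. Clozel, *Simple algebras, base change, and the advanced theory of the trace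
  formula*, Ann. of Math. Stud. 120 (1989), Ch. 3, Def. 6.1, Thm. 6.2, Lemma 6.4.
  [ArthurClozelAMS120]
* S. Gelbart, *Three lectures on the modularity of `ρ̄_{E,3}` and the Langlands reciprocity
  conjecture* (1997), Thm. 5.3.1, Remarks 5.3.1 (a), (e). [Gelbart1997]
* H. Jacquet, I. I. Piatetski-Shapiro, J. Shalika, *Automorphic forms on GL(3) II*, Ann. of Math.
  109 (1979), §§13–14. [JacquetPiatetskishapiroShalika1979II]
* A. Borel, H. Jacquet, *Automorphic forms and automorphic representations*, Proc. Sympos. Pure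
  Math. 33 (1979), part 1, 4.4–4.6. [BorelJacquet1979]
* J. W. S. Cassels, A. Fröhlich (eds.), *Algebraic Number Theory* (1967), Ch. VII (Tate), §1.1,
  Prop. 1.2 (ii), §4 Prop. 4.1. [CasselsFrohlichANT1967]
-/

noncomputable section

open scoped NumberField Polynomial Classical
open NumberField IsDedekindDomain Polynomial Filter Literature.NumberTheory.Automorphic

namespace Literature.NumberTheory.Automorphic

/-! ### Bookkeeping: transport along an equality of ranks, `GL₁` cusp forms, cyclicity -/

section Transport

variable {K : Type} [Field K] [NumberField K]

/-- Transport of an automorphic representation datum along an equality of ranks `m = n`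
(the automorphy data `AutomorphyDatum.gl m K _` and `AutomorphyDatum.gl n K _` then coincide),
preserving Satake parameters. [folklore] -/
theorem AutomorphicRepData.exists_hasSatakeParamAt_iff_of_eq {m n : ℕ} (h : m = n)
    (hm : isCompact_glFiniteIntegralLevel m K) (hn : isCompact_glFiniteIntegralLevel n K)
    (P : AutomorphicRepData (AutomorphyDatum.gl m K hm)) :
    ∃ Q : AutomorphicRepData (AutomorphyDatum.gl n K hn),
      ∀ (v : HeightOneSpectrum (𝓞 K)) (α : Multiset ℂ),
        Q.HasSatakeParamAt v α ↔ P.HasSatakeParamAt v α := by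
  subst h
  exact ⟨P, fun _ _ => Iff.rfl⟩

/-- Transport of a cuspidal automorphic representation datum along an equality of ranks,
preserving Satake parameters. [folklore] -/
theorem CuspidalAutomorphicRepData.exists_hasSatakeParamAt_iff_of_eq {m n : ℕ} (h : m = n)
    (hm : isCompact_glFiniteIntegralLevel m K) (hn : isCompact_glFiniteIntegralLevel n K)
    (P : CuspidalAutomorphicRepData m K hm) :
    ∃ Q : CuspidalAutomorphicRepData n K hn,
      ∀ (v : HeightOneSpectrum (𝓞 K)) (α : Multiset ℂ),
        Q.1.HasSatakeParamAt v α ↔ P.1.HasSatakeParamAt v α := by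
  subst h
  exact ⟨P, fun _ _ => Iff.rfl⟩

/-- For `n = 1` the cusp conditions are empty, so cusp forms on `GL₁(𝔸_K)` are all the
automorphic forms (Borel–Jacquet 1979, 4.4; the tree's `cuspFormsGL_one_eq` of
`TunnellCubicLifts`, re-proved here to keep the imports of this file small).
[cite: BorelJacquet1979, 4.4] -/
theorem cuspFormsGL_one_eq_automorphicForms (h : isCompact_glFiniteIntegralLevel 1 K) :
    cuspFormsGL 1 K h = automorphicForms (AutomorphyDatum.gl 1 K h) := by
  unfold cuspFormsGL automorphicForms
  congr 1
  ext φ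
  simp only [Set.mem_setOf_eq, IsCuspFormGL, and_iff_left_iff_imp]
  intro _ k hk hk1
  exact absurd hk1 (by omega)

/-- Every automorphic representation datum of `GL₁(𝔸_K)` is a cuspidal datum
(`cuspFormsGL_one_eq_automorphicForms`). [cite: BorelJacquet1979, 4.4] -/
theorem AutomorphicRepData.W_le_cuspFormsGL_one {h : isCompact_glFiniteIntegralLevel 1 K}
    (τ : AutomorphicRepData (AutomorphyDatum.gl 1 K h)) : τ.W ≤ cuspFormsGL 1 K h := by
  rw [cuspFormsGL_one_eq_automorphicForms]
  exact τ.stable.le_automorphicForms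

end Transport

section Cyclic

variable {F E : Type} [Field F] [Field E] [Algebra F E]

/-- A Galois extension of prime degree has cyclic Galois group (its order is the degree,
`IsGalois.card_aut_eq_finrank`). [folklore] -/
theorem isCyclic_algEquiv_of_finrank_prime [FiniteDimensional F E] [IsGalois F E]
    (hp : (Module.finrank F E).Prime) : IsCyclic (E ≃ₐ[F] E) :=
  haveI : Fact (Module.finrank F E).Prime := ⟨hp⟩
  isCyclic_of_prime_card (IsGalois.card_aut_eq_finrank F E)

end Cyclic

/-! ### Clause (1) for `E/F` Galois: existence from `automorphicInduction_cyclic` -/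

section Existence

variable {F E : Type} [Field F] [NumberField F] [Field E] [NumberField E] [Algebra F E]

/-- **The Galois case of clause (1) of `automorphicInduction_unitaryCharacter_cubic` from
Arthur–Clozel's Theorem 6.2.**  Let `E/F` be a GALOIS extension of number fields of degree `3`
(hence cyclic) and `θ` any Hecke character of `E`.  Granting `automorphicInduction_cyclic`
(Arthur–Clozel 1989, Ch. 3, Thm. 6.2: automorphic induction through a cyclic extension, with the
Hecke-eigenvalue relations of Def. 6.1), there is an automorphic representation `π` of `GL₃(𝔸_F)`
with `det(X - t_{π,v}) = ∏_{w ∣ v} (X^{f(w|v)} - θ(ϖ_w))` for almost every finite place `v` of `F`: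
apply the fact to the (cuspidal) datum `π_θ` of `GL₁(𝔸_E)` with Satake parameters `{θ(ϖ_w)}`
(`exists_automorphicRepData_hasSatakeParamAt_valueAtUniformizer`) and read Def. 6.1 for `n = 1`
as the character identity (`isAutomorphicInductionAlong_iff_of_hasSatakeParamAt_singleton`).
[cite: ArthurClozelAMS120, Ch. 3 Thm. 6.2 and Def. 6.1] [cite: Gelbart1997, Thm. 5.3.1] -/
theorem exists_automorphicRepData_cubic_of_isGalois (hAI : automorphicInduction_cyclic)
    [IsGalois F E] (h3 : Module.finrank F E = 3) (θ : GaloisRepresentations.HeckeCharacter E)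
    (hF : isCompact_glFiniteIntegralLevel 3 F) :
    ∃ π : AutomorphicRepData (AutomorphyDatum.gl 3 F hF),
      ∀ᶠ v : HeightOneSpectrum (𝓞 F) in cofinite, ∃ α : Multiset ℂ,
        π.HasSatakeParamAt v α ∧
          satakePolynomial α =
            ∏ᶠ w ∈ {w : HeightOneSpectrum (𝓞 E) | w.under (𝓞 F) = v},
              (X ^ w.asIdeal.inertiaDeg (𝓞 F) - C (θ.valueAtUniformizer w)) := by
  have hcyc : IsCyclic (E ≃ₐ[F] E) :=
    isCyclic_algEquiv_of_finrank_prime (F := F) (E := E) (h3 ▸ Nat.prime_three)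
  set hE := isCompact_glFiniteIntegralLevel_holds 1 E
  obtain ⟨τ, hτ⟩ := exists_automorphicRepData_hasSatakeParamAt_valueAtUniformizer hE θ
  set hK := isCompact_glFiniteIntegralLevel_holds (1 * Module.finrank F E) F
  obtain ⟨P, hP⟩ := hAI 1 F E hcyc one_pos hE hK ⟨τ, τ.W_le_cuspFormsGL_one⟩
  have hP' := (isAutomorphicInductionAlong_iff_of_hasSatakeParamAt_singleton θ hτ P).1 hP
  obtain ⟨π, hπ⟩ := AutomorphicRepData.exists_hasSatakeParamAt_iff_of_eq
    (show 1 * Module.finrank F E = 3 by rw [h3]) hK hF P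
  refine ⟨π, ?_⟩
  filter_upwards [hP'] with v hv
  obtain ⟨α, hα, hαθ⟩ := hv
  exact ⟨α, (hπ v α).2 hα, hαθ⟩

/-- The Galois case of clause (1), for a unitary `θ` as in the fact (the unitarity is not used).
[cite: ArthurClozelAMS120, Ch. 3 Thm. 6.2] -/
theorem exists_automorphicRepData_cubic_of_isGalois_of_isUnitary
    (hAI : automorphicInduction_cyclic) [IsGalois F E] (h3 : Module.finrank F E = 3)
    (θ : GaloisRepresentations.HeckeCharacter E) (_hθ : θ.IsUnitary)
    (hF : isCompact_glFiniteIntegralLevel 3 F) :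
    ∃ π : AutomorphicRepData (AutomorphyDatum.gl 3 F hF),
      ∀ᶠ v : HeightOneSpectrum (𝓞 F) in cofinite, ∃ α : Multiset ℂ,
        π.HasSatakeParamAt v α ∧
          satakePolynomial α =
            ∏ᶠ w ∈ {w : HeightOneSpectrum (𝓞 E) | w.under (𝓞 F) = v},
              (X ^ w.asIdeal.inertiaDeg (𝓞 F) - C (θ.valueAtUniformizer w)) :=
  exists_automorphicRepData_cubic_of_isGalois hAI h3 θ hF

end Existence

/-! ### Clause (2) for `E/F` Galois: cuspidality from `automorphicInduction_cyclic_cuspidal` -/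

section Cuspidal

variable {F E : Type} [Field F] [NumberField F] [Field E] [NumberField E] [Algebra F E]

/-- **Galois-stable Satake data of `π_θ` means Galois-stable values of `θ`, almost everywhere.**
If the automorphic representation datum `τ` of `GL₁(𝔸_E)` has Satake parameter `{θ(ϖ_w)}` at
almost every `w` and its Satake data are `Gal(E/F)`-stable almost everywhere
(`IsGaloisStableSatakeAE`), then for almost every place `w` of `E`, `θ(ϖ_{w'}) = θ(ϖ_w)` for
every place `w'` of `E` over the same place of `F` (uniqueness of Satake parameters,
`AutomorphicRepData.hasSatakeParamAt_unique_holds`; the finitely many bad `w'` lie over finitely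
many places of `F`, `eventually_forall_under_eq`, `eventually_under`). [folklore] -/
theorem eventually_valueAtUniformizer_eq_of_isGaloisStableSatakeAE
    {hE : isCompact_glFiniteIntegralLevel 1 E} (θ : GaloisRepresentations.HeckeCharacter E)
    {τ : AutomorphicRepData (AutomorphyDatum.gl 1 E hE)}
    (hτ : ∀ᶠ w : HeightOneSpectrum (𝓞 E) in cofinite,
      τ.HasSatakeParamAt w {θ.valueAtUniformizer w})
    (hst : IsGaloisStableSatakeAE F τ) :
    ∀ᶠ w : HeightOneSpectrum (𝓞 E) in cofinite, ∀ w' : HeightOneSpectrum (𝓞 E),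
      w'.asIdeal.under (𝓞 F) = w.asIdeal.under (𝓞 F) →
        θ.valueAtUniformizer w' = θ.valueAtUniformizer w := by
  have hτ' : ∀ᶠ w : HeightOneSpectrum (𝓞 E) in cofinite, ∀ w' : HeightOneSpectrum (𝓞 E),
      w'.asIdeal.under (𝓞 F) = w.asIdeal.under (𝓞 F) →
        τ.HasSatakeParamAt w' {θ.valueAtUniformizer w'} := by
    filter_upwards [eventually_under (E := E) (eventually_forall_under_eq (F := F) hτ)]
      with w hw w' hw'
    exact hw (w.under (𝓞 F)) rfl w' hw'
  filter_upwards [hst, hτ, hτ'] with w hstw hτw hτ'w w' hw'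
  exact Multiset.singleton_inj.1
    (τ.hasSatakeParamAt_unique_holds (hτ'w w' hw') (hstw w' hw' _ hτw))

/-- **Contrapositive**: if for infinitely many places `w` of `E` some place `w'` over the same
place of `F` has `θ(ϖ_{w'}) ≠ θ(ϖ_w)`, then the Satake data of `π_θ` are not `Gal(E/F)`-stable
almost everywhere — the hypothesis of `automorphicInduction_cyclic_cuspidal` (the shadow of
Arthur–Clozel's "`π_E ≇ π_E^σ`", Lemma 6.4). [cite: ArthurClozelAMS120, Ch. 3 Lemma 6.4] -/
theorem not_isGaloisStableSatakeAE_of_frequently_ne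
    {hE : isCompact_glFiniteIntegralLevel 1 E} (θ : GaloisRepresentations.HeckeCharacter E)
    {τ : AutomorphicRepData (AutomorphyDatum.gl 1 E hE)}
    (hτ : ∀ᶠ w : HeightOneSpectrum (𝓞 E) in cofinite,
      τ.HasSatakeParamAt w {θ.valueAtUniformizer w})
    (hθ : ∃ᶠ w : HeightOneSpectrum (𝓞 E) in cofinite, ∃ w' : HeightOneSpectrum (𝓞 E),
      w'.asIdeal.under (𝓞 F) = w.asIdeal.under (𝓞 F) ∧
        θ.valueAtUniformizer w' ≠ θ.valueAtUniformizer w) :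
    ¬ IsGaloisStableSatakeAE F τ := fun hst =>
  hθ ((eventually_valueAtUniformizer_eq_of_isGaloisStableSatakeAE θ hτ hst).mono
    fun _ hw ⟨w', hw', hne⟩ => hne (hw w' hw'))

/-- **Regularity at one place spreads to infinitely many places** (rigidity of Hecke
characters).  Let `E/F` be Galois and `θ` a Hecke character of `E`.  If two places `w ≠ w'` of
`E` over one place of `F`, with `θ` unramified at `w'`, have `θ(ϖ_w) ≠ θ(ϖ_{w'})`, then for
infinitely many places `w₁` of `E` some place over the same place of `F` has a different value
of `θ`.  Otherwise, with `σ ∈ Gal(E/F)` moving `w` to `w'` (transitivity,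
`HeightOneSpectrum.exists_algEquiv_smul_eq`), the conjugate Hecke character
`θ^σ : x ↦ θ(σ • x)` (continuous, `ideleGroup_continuous_smul`; trivial on `E^×`,
`smul_mem_principalIdeles`) would agree with `θ` at the uniformizers of almost all places
(`θ^σ(ϖ_{w₁}) = θ(ϖ_{σ w₁})` off the ramification of `θ`,
`HeckeCharacter.coe_apply_smul_localUnits_uniformizer`), hence `θ^σ = θ`
(`HeckeCharacter.ext_of_eventually_valueAtUniformizer_eq`, Cassels–Fröhlich VII Prop. 4.1),
and then `θ(ϖ_{w'}) = θ^σ(ϖ_w) = θ(ϖ_w)`. This upgrades the single-place regularity hypothesis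
of the character-induction facts to the almost-everywhere non-stability consumed by
`automorphicInduction_cyclic_cuspidal`. [cite: CasselsFrohlichANT1967, Ch. VII §4 Prop. 4.1 and §1.1] -/
theorem _root_.Literature.NumberTheory.GaloisRepresentations.HeckeCharacter.frequently_exists_valueAtUniformizer_ne
    [IsGalois F E] (θ : GaloisRepresentations.HeckeCharacter E) {w w' : HeightOneSpectrum (𝓞 E)}
    (hww' : w.under (𝓞 F) = w'.under (𝓞 F)) (hu' : θ.IsUnramifiedAt w')
    (hne : θ.valueAtUniformizer w ≠ θ.valueAtUniformizer w') :
    ∃ᶠ w₁ : HeightOneSpectrum (𝓞 E) in cofinite, ∃ w₂ : HeightOneSpectrum (𝓞 E),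
      w₂.asIdeal.under (𝓞 F) = w₁.asIdeal.under (𝓞 F) ∧
        θ.valueAtUniformizer w₂ ≠ θ.valueAtUniformizer w₁ := by
  obtain ⟨σ, hσ⟩ := HeightOneSpectrum.exists_algEquiv_smul_eq (F := F) hww'
  subst hσ
  by_contra hcon
  rw [Filter.not_frequently] at hcon
  -- the conjugate character `θ^σ`
  let θσ : GaloisRepresentations.HeckeCharacter E :=
    { toContinuousMonoidHom :=
        { toMonoidHom := θ.toContinuousMonoidHom.toMonoidHom.comp
            (MulDistribMulAction.toMonoidHom (GaloisRepresentations.ideleGroup E) σ)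
          continuous_toFun := (map_continuous θ.toContinuousMonoidHom).comp
            (ideleGroup_continuous_smul F E σ) }
      map_principal' := fun x hx => θ.map_principal (smul_mem_principalIdeles F E σ hx) }
  have happ : ∀ x, θσ x = θ (σ • x) := fun _ => rfl
  have hval : ∀ w₁ : HeightOneSpectrum (𝓞 E), θ.IsUnramifiedAt (σ • w₁) →
      θσ.valueAtUniformizer w₁ = θ.valueAtUniformizer (σ • w₁) := fun w₁ h₁ => by
    rw [← θ.coe_apply_smul_localUnits_uniformizer σ w₁ h₁, ← happ]
    rfl
  -- `θ` is unramified at `σ w₁` for almost all `w₁`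
  have hur : ∀ᶠ v in cofinite, θ.IsUnramifiedAt v :=
    θ.finite_ramifiedPlaces_iff.1 (GaloisRepresentations.HeckeCharacter.finite_ramifiedPlaces_holds θ)
  have hur' : ∀ᶠ w₁ : HeightOneSpectrum (𝓞 E) in cofinite, θ.IsUnramifiedAt (σ • w₁) :=
    (MulAction.injective σ).tendsto_cofinite.eventually hur
  -- hence `θ^σ = θ`
  have heq : θσ = θ := by
    refine GaloisRepresentations.HeckeCharacter.ext_of_eventually_valueAtUniformizer_eq ?_
    filter_upwards [hur', hcon] with w₁ h₁ h₂
    rw [hval w₁ h₁]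
    by_contra h
    exact h₂ ⟨σ • w₁, congrArg HeightOneSpectrum.asIdeal
      (HeightOneSpectrum.under_algEquiv_smul F E σ w₁), h⟩
  -- and `θ(ϖ_{σ w}) = θ^σ(ϖ_w) = θ(ϖ_w)`
  refine hne ?_
  rw [← hval w hu', heq]

/-- The regularity hypothesis of the character-induction facts
(`automorphicInduction_character(_cubic)`, `automorphicInduction_unitaryCharacter_cubic`:
two distinct places over one place of `F`, of equal residue degree, unramified for `θ`, with
different values of `θ`) implies the almost-everywhere non-stability
(`frequently_exists_valueAtUniformizer_ne`). [folklore] -/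
theorem _root_.Literature.NumberTheory.GaloisRepresentations.HeckeCharacter.frequently_exists_valueAtUniformizer_ne_of_regular
    [IsGalois F E] (θ : GaloisRepresentations.HeckeCharacter E)
    (hreg : ∃ (v : HeightOneSpectrum (𝓞 F)) (w w' : HeightOneSpectrum (𝓞 E)), w ≠ w' ∧
      w.under (𝓞 F) = v ∧ w'.under (𝓞 F) = v ∧
      w.asIdeal.inertiaDeg (𝓞 F) = w'.asIdeal.inertiaDeg (𝓞 F) ∧
      θ.IsUnramifiedAt w ∧ θ.IsUnramifiedAt w' ∧
      θ.valueAtUniformizer w ≠ θ.valueAtUniformizer w') :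
    ∃ᶠ w₁ : HeightOneSpectrum (𝓞 E) in cofinite, ∃ w₂ : HeightOneSpectrum (𝓞 E),
      w₂.asIdeal.under (𝓞 F) = w₁.asIdeal.under (𝓞 F) ∧
        θ.valueAtUniformizer w₂ ≠ θ.valueAtUniformizer w₁ := by
  obtain ⟨v, w, w', -, hw, hw', -, -, hu', hne⟩ := hreg
  exact θ.frequently_exists_valueAtUniformizer_ne (hw.trans hw'.symm) hu' hne

/-- **The Galois case of clause (2) of `automorphicInduction_unitaryCharacter_cubic`, from
Arthur–Clozel's Theorem 6.2 / Lemma 6.4, under the almost-everywhere non-stability of `θ`.**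
Let `E/F` be Galois of degree `3` and `θ` a Hecke character of `E` such that for infinitely many
places `w` of `E` some place over the same place of `F` has a different value of `θ`.  Granting
`automorphicInduction_cyclic_cuspidal` (cyclic automorphic induction of prime degree is
cuspidal off the Galois-stable locus), there is a CUSPIDAL automorphic representation `π` of
`GL₃(𝔸_F)` with `det(X - t_{π,v}) = ∏_{w ∣ v} (X^{f(w|v)} - θ(ϖ_w))` for almost every `v`.
[cite: ArthurClozelAMS120, Ch. 3 Thm. 6.2 and Lemma 6.4] [cite: Gelbart1997, Thm. 5.3.1] -/
theorem exists_cuspidal_cubic_of_isGalois_of_frequently_ne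
    (hAIc : automorphicInduction_cyclic_cuspidal) [IsGalois F E] (h3 : Module.finrank F E = 3)
    (θ : GaloisRepresentations.HeckeCharacter E)
    (hθ : ∃ᶠ w : HeightOneSpectrum (𝓞 E) in cofinite, ∃ w' : HeightOneSpectrum (𝓞 E),
      w'.asIdeal.under (𝓞 F) = w.asIdeal.under (𝓞 F) ∧
        θ.valueAtUniformizer w' ≠ θ.valueAtUniformizer w)
    (hF : isCompact_glFiniteIntegralLevel 3 F) :
    ∃ π : CuspidalAutomorphicRepData 3 F hF,
      ∀ᶠ v : HeightOneSpectrum (𝓞 F) in cofinite, ∃ α : Multiset ℂ,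
        π.1.HasSatakeParamAt v α ∧
          satakePolynomial α =
            ∏ᶠ w ∈ {w : HeightOneSpectrum (𝓞 E) | w.under (𝓞 F) = v},
              (X ^ w.asIdeal.inertiaDeg (𝓞 F) - C (θ.valueAtUniformizer w)) := by
  have hp : (Module.finrank F E).Prime := h3 ▸ Nat.prime_three
  have hcyc : IsCyclic (E ≃ₐ[F] E) := isCyclic_algEquiv_of_finrank_prime hp
  set hE := isCompact_glFiniteIntegralLevel_holds 1 E
  obtain ⟨τ, hτ⟩ := exists_automorphicRepData_hasSatakeParamAt_valueAtUniformizer hE θ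
  set hK := isCompact_glFiniteIntegralLevel_holds (1 * Module.finrank F E) F
  obtain ⟨P, hP⟩ := hAIc 1 F E hcyc hp one_pos hE hK ⟨τ, τ.W_le_cuspFormsGL_one⟩
    (not_isGaloisStableSatakeAE_of_frequently_ne θ hτ hθ)
  have hP' := (isAutomorphicInductionAlong_iff_of_hasSatakeParamAt_singleton θ hτ P.1).1 hP
  obtain ⟨π, hπ⟩ := CuspidalAutomorphicRepData.exists_hasSatakeParamAt_iff_of_eq
    (show 1 * Module.finrank F E = 3 by rw [h3]) hK hF P
  refine ⟨π, ?_⟩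
  filter_upwards [hP'] with v hv
  obtain ⟨α, hα, hαθ⟩ := hv
  exact ⟨α, (hπ v α).2 hα, hαθ⟩

/-- **The Galois case of clause (2) of `automorphicInduction_unitaryCharacter_cubic`, verbatim**
(the regularity hypothesis of the fact; `E/F` Galois of degree `3`), from
`automorphicInduction_cyclic_cuspidal` via `frequently_exists_valueAtUniformizer_ne_of_regular`.
[cite: ArthurClozelAMS120, Ch. 3 Thm. 6.2 and Lemma 6.4] [cite: Gelbart1997, Thm. 5.3.1] -/
theorem exists_cuspidal_cubic_of_isGalois (hAIc : automorphicInduction_cyclic_cuspidal)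
    [IsGalois F E] (h3 : Module.finrank F E = 3) (θ : GaloisRepresentations.HeckeCharacter E)
    (hreg : ∃ (v : HeightOneSpectrum (𝓞 F)) (w w' : HeightOneSpectrum (𝓞 E)), w ≠ w' ∧
      w.under (𝓞 F) = v ∧ w'.under (𝓞 F) = v ∧
      w.asIdeal.inertiaDeg (𝓞 F) = w'.asIdeal.inertiaDeg (𝓞 F) ∧
      θ.IsUnramifiedAt w ∧ θ.IsUnramifiedAt w' ∧
      θ.valueAtUniformizer w ≠ θ.valueAtUniformizer w')
    (hF : isCompact_glFiniteIntegralLevel 3 F) :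
    ∃ π : CuspidalAutomorphicRepData 3 F hF,
      ∀ᶠ v : HeightOneSpectrum (𝓞 F) in cofinite, ∃ α : Multiset ℂ,
        π.1.HasSatakeParamAt v α ∧
          satakePolynomial α =
            ∏ᶠ w ∈ {w : HeightOneSpectrum (𝓞 E) | w.under (𝓞 F) = v},
              (X ^ w.asIdeal.inertiaDeg (𝓞 F) - C (θ.valueAtUniformizer w)) :=
  exists_cuspidal_cubic_of_isGalois_of_frequently_ne hAIc h3 θ
    (θ.frequently_exists_valueAtUniformizer_ne_of_regular hreg) hF

end Cuspidal

/-! ### The fact for Galois `E/F`, assembled -/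

/-- **`automorphicInduction_unitaryCharacter_cubic` for GALOIS cubic extensions follows from
Arthur–Clozel's cyclic automorphic induction** (the tree's named facts
`automorphicInduction_cyclic`, Thm. 6.2, and `automorphicInduction_cyclic_cuspidal`, Thm. 6.2 with
Lemma 6.4): both clauses of the fact, for every `E/F` Galois of degree `3` and every Hecke
character `θ` (the unitarity plays no role).  The non-Galois case — the content proper of the
fact (Jacquet–Piatetski-Shapiro–Shalika's converse theorem for `GL(3)`, Gelbart 1997,
Remark 5.3.1 (e)) — is not touched. [cite: ArthurClozelAMS120, Ch. 3 Thm. 6.2 and Lemma 6.4]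
[cite: Gelbart1997, Thm. 5.3.1 and Remark 5.3.1 (e)] -/
theorem automorphicInduction_unitaryCharacter_cubic_of_isGalois
    (hAI : automorphicInduction_cyclic) (hAIc : automorphicInduction_cyclic_cuspidal)
    (F E : Type) [Field F] [NumberField F] [Field E] [NumberField E] [Algebra F E] [IsGalois F E]
    (h3 : Module.finrank F E = 3) (θ : GaloisRepresentations.HeckeCharacter E) (_hθ : θ.IsUnitary)
    (hF : isCompact_glFiniteIntegralLevel 3 F) :
    (∃ π : AutomorphicRepData (AutomorphyDatum.gl 3 F hF),
      ∀ᶠ v : HeightOneSpectrum (𝓞 F) in cofinite, ∃ α : Multiset ℂ,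
        π.HasSatakeParamAt v α ∧
          satakePolynomial α =
            ∏ᶠ w ∈ {w : HeightOneSpectrum (𝓞 E) | w.under (𝓞 F) = v},
              (X ^ w.asIdeal.inertiaDeg (𝓞 F) - C (θ.valueAtUniformizer w))) ∧
    ((∃ (v : HeightOneSpectrum (𝓞 F)) (w w' : HeightOneSpectrum (𝓞 E)), w ≠ w' ∧
        w.under (𝓞 F) = v ∧ w'.under (𝓞 F) = v ∧
        w.asIdeal.inertiaDeg (𝓞 F) = w'.asIdeal.inertiaDeg (𝓞 F) ∧
        θ.IsUnramifiedAt w ∧ θ.IsUnramifiedAt w' ∧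
        θ.valueAtUniformizer w ≠ θ.valueAtUniformizer w') →
      ∃ π : CuspidalAutomorphicRepData 3 F hF,
        ∀ᶠ v : HeightOneSpectrum (𝓞 F) in cofinite, ∃ α : Multiset ℂ,
          π.1.HasSatakeParamAt v α ∧
            satakePolynomial α =
              ∏ᶠ w ∈ {w : HeightOneSpectrum (𝓞 E) | w.under (𝓞 F) = v},
                (X ^ w.asIdeal.inertiaDeg (𝓞 F) - C (θ.valueAtUniformizer w))) :=
  ⟨exists_automorphicRepData_cubic_of_isGalois hAI h3 θ hF,
    fun hreg => exists_cuspidal_cubic_of_isGalois hAIc h3 θ hreg hF⟩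

end Literature.NumberTheory.Automorphic

end
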